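import Summits.QuantumFields.BalabanUV.T4Continuum.Support.T4TrajectoryDensityPerFamily

/-!
# `T4Continuum.T4TrajectoryDensityPositive` — at a REAL regular background the normalised operation is a probability average:
# sup cost EXACTLY `1`, and the per-family chain accepts ANY `ContStepLawOn` instance (answer, in kernel, to the ideation seat's
# Route L question Q-L4, `t4/b2b-balaban-t4-ne1p-p2-g18/NE1p-MARKOV-g18.md` §7) (cell `pub-balaban`, sub-cell `t4`, spine
# estimate NE1′ (node O3b/H2), lineage t4-ne1p-p1 = PROVER seat P1 «RG-trajectory comparison», generation 22; tree target
# `Summits/QuantumFields/BalabanUV/T4Continuum/Support/`; ADDITIVE — imports `T4TrajectoryDensityPerFamily` ONLY)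

HONEST FRAMING.  Finite four-torus, rung (B)+1 only — NOT infinite volume, NOT a mass gap, NOT the Clay problem, NOT summit
progress.  «continuum YM on T⁴ ⇐ BetaPertH ∧ nine spine estimates (0/9 proved); BetaPertH ⇐ (D1) ∧ (D4) ∧ CAP+tail; G-an2-4
gates asym, D1 and NE2/3/4».  [folklore] kernel ((1.75) with `σ = 0` by name, i.e. the triangle inequality for a probability
average), 0 sorry, 0 citations; nothing of Bałaban's densities is asserted.

CONTENTS (§21).  Q-L4 asked: «does the `wOp`∕`expWeight` layer admit the factorisation `𝒫(ρ·h) = 𝒫(ρ)·E[h]` with `E` positive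
and normalised AT THE SAME background, i.e. is there a real-operation twin of `wOp (expWeight (base k) 𝒜)` normalised at `U`?»
ANSWER: `wOp ω μ z₀ U h = (∫ ω_U dμ)⁻¹ • ∫ ω_U • h dμ` IS normalised at the SAME background `U` by definition
(`T4TrajectoryDensity.wOp_of_pos`; there is no base point in it — the base point `ref` enters only the SLICE data `RealBaseAt`∕
`ExponentSliceAt` that the analytic supplier needs).  At a background `U` where the weight is (a.e.) a NONNEGATIVE REAL density
of positive mass — every real regular configuration of a window — the operation is a probability average, hence:
`wOp_realWeight_sub_le` — its sup cost on differences of class integrands is EXACTLY `1` (`norm_ratio_le` with `σ = 0`: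
`e^{3·0} = 1`); `supCost_one_of_realWindow` — the `supCost` field of a `ContStepLawOn` with `a = 1` at every admissible base
that is such a background.  So Route L's instance «`a = 1` by positivity + `bgLip` = a real tilt modulus» plugs into the
per-family chain at `T4TrajectoryDensityPerFamily.cont_of_contStepLawOn_fam` (which takes ANY `ContStepLawOn` per `(b, k′, k)`;
the induction underneath, `T4TrajectoryModulus.transportsFromVar_of_moduli_dep`, is operation-free) with `α k := 1 + ℓ·ω`
(the `hdom` of `cont_of_contStepLawOn_fam` with `a b k = 1`): the analytic route's `e^{3s}` is the price of evaluating the SAME operation at COMPLEX backgrounds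
(needed only because P1 gets `bgLip` from analyticity via Cauchy), not a property of the operation.  What Route L must still
supply is its `bgLip` (the tilt modulus along P1's admissible pairs) and the births' moduli — not typed here.
-/

namespace Summit.QuantumFields.BalabanUV.T4Continuum.T4TrajectoryDensityDressed

open MeasureTheory Set Metric Filter
open Literature.MathematicalPhysics.QuantumFieldTheory.Balaban1983to89
open T4TermFormat T4TrajectoryComparison T4TrajectoryModulus
open T4TrajectoryDensity

noncomputable section

section Positive

variable {Z : Type*} [MeasurableSpace Z] {𝒰 : Type*} {F : Type*} [NormedAddCommGroup F] [NormedSpace ℂ F]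

/-- **AT A REAL NONNEGATIVE WEIGHT THE NORMALISED OPERATION HAS SUP COST EXACTLY `1`.**  If the weight slice at `U` is a.e. the
real density `ρ ≥ 0` (integrable, positive mass), then for class integrands `g, g′` with `‖g − g′‖ ≤ m` a.e.:
`‖wOp ω μ z₀ U g − wOp ω μ z₀ U g′‖ ≤ m` — `wOp_sub` + (1.75) with `σ = 0` (`norm_ratio_le`, `e^{3·0} = 1`).  No base point, no
analyticity, no `e^{3s}`. [folklore] -/
theorem wOp_realWeight_sub_le {ω : 𝒰 → Z → ℂ} {μ : Measure Z} {z₀ : Z} {U : 𝒰} {ρ : Z → ℝ} {g g' : Z → F} {m : ℝ}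
    (hω : ω U =ᵐ[μ] fun z => ((ρ z : ℝ) : ℂ)) (hρ : Integrable ρ μ) (hρ0 : 0 ≤ᵐ[μ] ρ) (hP : 0 < ∫ z, ρ z ∂μ)
    (hg : g ∈ BddClass F μ) (hg' : g' ∈ BddClass F μ) (hm : 0 ≤ m) (hdiff : ∀ᵐ z ∂μ, ‖g z - g' z‖ ≤ m) :
    ‖wOp ω μ z₀ U g - wOp ω μ z₀ U g'‖ ≤ m := by
  -- the weight slice is `weight ρ 0`
  have hωw : ω U =ᵐ[μ] weight ρ (fun _ => (0 : ℂ)) :=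
    hω.mono fun z hz => by rw [hz, weight_apply, Complex.exp_zero, mul_one]
  have hσm : AEStronglyMeasurable (fun _ : Z => (0 : ℂ)) μ := aestronglyMeasurable_const
  have hσb : ∀ᵐ z ∂μ, ‖(fun _ : Z => (0 : ℂ)) z‖ ≤ 0 := Eventually.of_forall fun _ => by simp
  have hWint : Integrable (weight ρ fun _ => (0 : ℂ)) μ := integrable_weight hρ hσm hσb
  have hint : Integrable (ω U) μ := hWint.congr hωw.symm
  have hI : ∫ z, ω U z ∂μ = ∫ z, weight ρ (fun _ => (0 : ℂ)) z ∂μ := integral_congr_ae hωw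
  have hne : (∫ z, ω U z ∂μ) ≠ 0 := by
    rw [hI]
    exact integral_weight_ne_zero hρ hρ0 hσm hσb zero_le_one hP
  rw [← wOp_sub ω μ z₀ U hg hg', wOp_of_pos hint hne, hI,
    integral_congr_ae (hωw.mono fun z hz => by simp only [Pi.sub_apply, hz] :
      (fun z => ω U z • (g - g') z) =ᵐ[μ] fun z => weight ρ (fun _ => (0 : ℂ)) z • (g z - g' z))]
  have h := norm_ratio_le (h := fun z => g z - g' z) hρ hρ0 hP hσm hσb zero_le_one hdiff hm
  simpa using h

/-- **THE `supCost` FIELD WITH `a = 1` ON A REAL WINDOW**: if every admissible base `U₀` of the pairs `Adm` carries a real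
nonnegative weight slice of positive mass, the normalised operation meets `ContStepLawOn`'s sup-cost clause on the class
`BddClass F μ` over a fluctuation domain `D` of full measure with constant EXACTLY `1`. [folklore] -/
theorem supCost_one_of_realWindow {ω : 𝒰 → Z → ℂ} {μ : Measure Z} {z₀ : Z} {D : Set Z} {Adm : 𝒰 → 𝒰 → ℝ → Prop}
    {w : ℝ} (hD : ∀ᵐ z ∂μ, z ∈ D) (hDne : D.Nonempty)
    (hreal : ∀ (U₀ U₁ : 𝒰) (δ : ℝ), Adm U₀ U₁ δ →
      ∃ ρ : Z → ℝ, (ω U₀ =ᵐ[μ] fun z => ((ρ z : ℝ) : ℂ)) ∧ Integrable ρ μ ∧ 0 ≤ᵐ[μ] ρ ∧ 0 < ∫ z, ρ z ∂μ) :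
    ∀ (U₀ U₁ : 𝒰) (δ : ℝ), Adm U₀ U₁ δ → δ ≤ w → ∀ g ∈ BddClass F μ, ∀ g' ∈ BddClass F μ, ∀ (m : ℝ),
      (∀ z ∈ D, ‖g z - g' z‖ ≤ m) → ‖wOp ω μ z₀ U₀ g - wOp ω μ z₀ U₀ g'‖ ≤ 1 * m := by
  intro U₀ U₁ δ hadm _ g hg g' hg' m hm
  obtain ⟨ρ, hω, hρ, hρ0, hP⟩ := hreal U₀ U₁ δ hadm
  obtain ⟨z, hz⟩ := hDne
  rw [one_mul]
  exact wOp_realWeight_sub_le hω hρ hρ0 hP hg hg' ((norm_nonneg _).trans (hm z hz)) (hD.mono fun z hz => hm z hz)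

end Positive

end

end Summit.QuantumFields.BalabanUV.T4Continuum.T4TrajectoryDensityDressed
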